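import Summits.ResolutionOfSingularities.ResolutionOfSingularities.Theorems.HilbertSamuelEliminationSigmaMaxModificationsCorridor3SigmaIsoDefs
import Summits.ResolutionOfSingularities.ResolutionOfSingularities.Theorems.HilbertSamuelEliminationSigmaMaxModificationsCorridor3WLadderMoving
import Summits.ResolutionOfSingularities.ResolutionOfSingularities.Theorems.HilbertSamuelEliminationSigmaMaxModificationsCorridor3WLadderIsoTailExtraction
import Summits.ResolutionOfSingularities.ResolutionOfSingularities.Theorems.HilbertSamuelEliminationSigmaMaxModificationsCorridor3WLadderIsoTransitionLaw
import HarnessLib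

/-!
# [OURS · L1 W4.2] σ-LAYER — `Corridor3SigmaIsoRows`: the ISOLATION rows for a strategy `σ` — Rec = Ev ⊔ Alt on the nose, the covers,
# Ev-Iso from the strategy-free KERNEL, ALT from the σ-laws, and the POINTED σ-CLOSER BY NAME
# (W4.2 DEAL D16-σ «ISOLATED ROWS ARE STRATEGY-FREE», res-L1-w42-plan-1 RULINGS v3.14-11a (CP) 2026-08-27T10:08:46Z → res-type-012;
# crux chain w42 `SigmaMaxModificationsCorridor3` stmt-ResolutionOfSingularities-19249 / crux stmt-…-18506;
# `--supports stmt-ResolutionOfSingularities-19249 --as helper`, counted 0)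

HONEST FRAMING. OURS proof bookkeeping (pure logic over the σ-vocabulary of `…Corridor3SigmaStepDefs` (res-D-pv-047) and
`…Corridor3SigmaIsoDefs` (res-type-012)); NOTHING here is a statement of H. Hironaka's manuscript [Hironaka2017] nor of
Cossart–Jannsen–Saito; theorem-only, fact-free (no named fact is consumed; no new definition). Every `theorem` is the σ-COPY of a
LANDED CJS-oracle theorem with the SAME proof term: `noMovingNearChainFrom_iff_recurrence` / `…_iff_trichotomy` (res-type-053 p496137,
res-type-012 p519348), `noMovingRecurrentNearChainFrom_iff_eventually_alternating` / `wtopRecIsoM_of_evIso_alt` /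
`wtopRecIsoM_pointed_of_kernel` (res-type-012 p521299), `atQ_of_coverA/B` / `wtopEvIsoM_of_towers` (res-type-012 p501384),
`wtopAltM_of_noRecurrentIsoPointBirth3` (res-type-067 p518912). AI-written; AI review is weaker than expert review.

THE σ-CLOSER (RULINGS v3.14-11a (CP) «`wtopRecIsoMσ_pointed_of_kernel`»), for EVERY strategy `σ` and EVERY origin class `Q`:

  `WtopRecIsoMσ σ p Q ⟸ IsoTailTowerExtractionMσ σ p ∧ IsoQuadraticTowerTerminates p 3 ∧ IsoTransitionLaw3σ σ p Q ∧ NoRecurrentIsoPointBirth3σ σ p Q`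

(`wtopRecIsoMσ_of_kernel`; the pointed instance `wtopRecIsoMσ_pointed_of_kernel`). The extraction binder is DISCHARGED for every
admissible functional σ in `…Corridor3SigmaIsoExtraction` (THE POINT: at an isolated stage every admissible centre through the marked point is
the point near the point); the transition law is expected to discharge likewise (σ-port of res-L1-type-o1's p520356); the birth law is the
conjecture-tagged OURS input, as for CJS. At `σ := Strategy.cjs R` all four binders are landed theorems / the landed row
(`wtopRecIsoMσ_cjs_of_birthLaw`), recovering p521299's `wtopRecIsoM_pointed_of_kernel_of_birthLaw` through the `Iff.rfl` transports.

## Contents (namespace `…Theorems.SigmaMaxModificationsCorridor3.Sigma`)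

* §0 chains: `reachesσ_chain`; monotonicity `noMovingNearChainFromσ_mono`, `noMovingRecurrentNearChainFromσ_mono`.
* §1 splits: `noMovingNearChainFromσ_iff_recurrence`, `noMovingNearChainFromσ_iff_trichotomy`,
  `noMovingRecurrentNearChainFromσ_iff_eventually_alternating`, `noMovingAlternatingNearChainFromσ_of_recurrent(_not)`.
* §2 rows: `wtopRecIsoMσ_of_evIso_alt`, `evIso_alt_of_wtopRecIsoMσ`, `wtopAltMσ_of_wtopRecIsoMσ`, `wtopAltMσ_of_wtopRecNonIsoMσ`,
  covers `atQσ_of_coverA`, `atQσ_of_coverB`, `atQσ_of_trichotomy`, `piecesσ_of_atQ` (the full W-top σ-row at `Q` ⟺ its four / three pieces).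
* §3 `wtopEvIsoMσ_of_towers : IsoQuadraticTowerTerminates p 3 → IsoTailTowerExtractionMσ σ p → ∀ Q, WtopEvIsoMσ σ p Q`.
* §4 `wtopAltMσ_of_noRecurrentIsoPointBirth3σ : IsoTransitionLaw3σ σ p Q → NoRecurrentIsoPointBirth3σ σ p Q → WtopAltMσ σ p Q`.
* §5 closers: `wtopRecIsoMσ_of_kernel`, `wtopRecIsoMσ_pointed_of_kernel`, `atQσ_of_kernel_evNonIso` (cover B with the kernel: the full W-top
  σ-row at `Q` from the four binders AND `WtopEvNonIsoMσ σ p Q`), and the CJS sanity instance `wtopRecIsoMσ_cjs_of_birthLaw`.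

## References (context only)

* V. Cossart, U. Jannsen, S. Saito, LNM 2270 (2020), Rem. 6.29 (1), Def. 6.38, Thm. 6.35, Thm. 6.40. [CossartJannsenSaito2020]
-/

noncomputable section

set_option linter.dupNamespace false -- mandated namespace of this single-conjunct summit

open CategoryTheory AlgebraicGeometry TopologicalSpace
open Summit.ResolutionOfSingularities.ResolutionOfSingularities.Theorems.CampaignW42
open Literature.AlgebraicGeometry.Resolution Literature.RingTheory.HilbertSamuel
open Literature.AlgebraicGeometry.CossartJannsenSaito2020
open Summit.ResolutionOfSingularities.ResolutionOfSingularities.Theorems.SigmaMaxModificationsCorridor3.Moving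
open Summit.ResolutionOfSingularities.ResolutionOfSingularities.Theorems.SigmaMaxModificationsCorridor3.Helpers (QPointed)
open Summit.ResolutionOfSingularities.ResolutionOfSingularities.Cruxes.SigmaMaxModifications.IdeasL1Idea2R4

namespace Summit.ResolutionOfSingularities.ResolutionOfSingularities.Theorems.SigmaMaxModificationsCorridor3.Sigma

universe u

variable {σ : Strategy.{u}} {N : ℕ} {ν : ℕ → ℕ}

/-! ## §0. Chains of σ-steps: reachability along a chain, monotonicity of the functionals -/

/-- Along a chain of σ-near steps whose start is σ-reached from `s₀`, every term is σ-reached from `s₀`. [folklore] -/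
theorem reachesσ_chain {s₀ : MarkedStage.{u}} {c : ℕ → MarkedStage.{u}} (h0 : Reachesσ σ N ν s₀ (c 0))
    (hstep : ∀ n, CanonicalNearStepσ σ N ν (c n) (c (n + 1))) (n : ℕ) : Reachesσ σ N ν s₀ (c n) := by
  induction n with
  | zero => exact h0
  | succ n ih => exact ih.tail (hstep n)

/-- Monotonicity of the moving σ-functional in the grade. [folklore] -/
theorem noMovingNearChainFromσ_mono {s₀ : MarkedStage.{u}} {G G' : MarkedStage.{u} → Prop} (hGG' : ∀ s, G s → G' s)
    (h : NoMovingNearChainFromσ σ N ν s₀ G') : NoMovingNearChainFromσ σ N ν s₀ G :=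
  fun ⟨c, h0, hstep, hG, hmov⟩ => h ⟨c, h0, hstep, fun n => hGG' _ (hG n), hmov⟩

/-- Monotonicity of the moving-recurrent σ-functional in the recurring predicate. [folklore] -/
theorem noMovingRecurrentNearChainFromσ_mono {s₀ : MarkedStage.{u}} {G B B' : MarkedStage.{u} → Prop}
    (hBB' : ∀ s, B s → B' s) (h : NoMovingRecurrentNearChainFromσ σ N ν s₀ G B') :
    NoMovingRecurrentNearChainFromσ σ N ν s₀ G B :=
  fun ⟨c, h0, hstep, hG, hmov, hio⟩ =>
    h ⟨c, h0, hstep, hG, hmov, fun n => (hio n).imp fun _ hm => ⟨hm.1, hBB' _ hm.2⟩⟩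

/-! ## §1. The recurrence split, the trichotomy, and Rec = Ev ⊔ Alt — for σ-chains -/

/-- **THE SPLIT for moving σ-chains**: no moving `G`-chain ⟺ none eventually outside `B` and none `B`-recurrent (σ-copy of
`noMovingNearChainFrom_iff_recurrence`, same proof). [folklore] -/
theorem noMovingNearChainFromσ_iff_recurrence {s₀ : MarkedStage.{u}} {G : MarkedStage.{u} → Prop} (B : MarkedStage.{u} → Prop) :
    NoMovingNearChainFromσ σ N ν s₀ G ↔
      (NoMovingNearChainFromσ σ N ν s₀ fun s => G s ∧ ¬ B s) ∧ NoMovingRecurrentNearChainFromσ σ N ν s₀ G B := by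
  constructor
  · intro h
    refine ⟨?_, ?_⟩
    · rintro ⟨c, h0, hstep, hG, hmov⟩
      exact h ⟨c, h0, hstep, fun n => (hG n).1, hmov⟩
    · rintro ⟨c, h0, hstep, hG, hmov, -⟩
      exact h ⟨c, h0, hstep, hG, hmov⟩
  · rintro ⟨htail, hrec⟩ ⟨c, h0, hstep, hG, hmov⟩
    rcases eventually_not_or_io (fun n => B (c n)) with ⟨n₀, hn₀⟩ | hio
    · exact htail ⟨fun n => c (n₀ + n), reachesσ_chain h0 hstep n₀, fun n => hstep (n₀ + n),
        fun n => ⟨hG _, hn₀ _ (Nat.le_add_right _ _)⟩, io_shift hmov n₀⟩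
    · exact hrec ⟨c, h0, hstep, hG, hmov, hio⟩

/-- **THE TRICHOTOMY SPLIT for moving σ-chains**: no moving `G`-chain from `s₀` ⟺ none eventually inside `B`, none eventually outside `B`,
and none alternating (σ-copy of `noMovingNearChainFrom_iff_trichotomy`, same proof). [folklore] -/
theorem noMovingNearChainFromσ_iff_trichotomy {s₀ : MarkedStage.{u}} {G : MarkedStage.{u} → Prop} (B : MarkedStage.{u} → Prop) :
    NoMovingNearChainFromσ σ N ν s₀ G ↔
      (NoMovingNearChainFromσ σ N ν s₀ fun s => G s ∧ B s) ∧ (NoMovingNearChainFromσ σ N ν s₀ fun s => G s ∧ ¬ B s) ∧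
        NoMovingAlternatingNearChainFromσ σ N ν s₀ G B := by
  constructor
  · intro h
    refine ⟨?_, ?_, ?_⟩
    · rintro ⟨c, h0, hstep, hG, hmov⟩
      exact h ⟨c, h0, hstep, fun n => (hG n).1, hmov⟩
    · rintro ⟨c, h0, hstep, hG, hmov⟩
      exact h ⟨c, h0, hstep, fun n => (hG n).1, hmov⟩
    · rintro ⟨c, h0, hstep, hG, hmov, -, -⟩
      exact h ⟨c, h0, hstep, hG, hmov⟩
  · rintro ⟨hin, hout, halt⟩ ⟨c, h0, hstep, hG, hmov⟩
    rcases eventually_not_or_io (fun n => B (c n)) with ⟨n₀, hn₀⟩ | hioB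
    · exact hout ⟨fun n => c (n₀ + n), reachesσ_chain h0 hstep n₀, fun n => hstep (n₀ + n),
        fun n => ⟨hG _, hn₀ _ (Nat.le_add_right _ _)⟩, io_shift hmov n₀⟩
    · rcases eventually_not_or_io (fun n => ¬ B (c n)) with ⟨n₀, hn₀⟩ | hioN
      · exact hin ⟨fun n => c (n₀ + n), reachesσ_chain h0 hstep n₀, fun n => hstep (n₀ + n),
          fun n => ⟨hG _, Classical.not_not.1 (hn₀ _ (Nat.le_add_right _ _))⟩, io_shift hmov n₀⟩
      · exact halt ⟨c, h0, hstep, hG, hmov, hioB, hioN⟩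

/-- An alternating σ-chain is in particular `B`-recurrent. [folklore] -/
theorem noMovingAlternatingNearChainFromσ_of_recurrent {s₀ : MarkedStage.{u}} {G B : MarkedStage.{u} → Prop}
    (h : NoMovingRecurrentNearChainFromσ σ N ν s₀ G B) : NoMovingAlternatingNearChainFromσ σ N ν s₀ G B :=
  fun ⟨c, h0, hstep, hG, hmov, hio, _⟩ => h ⟨c, h0, hstep, hG, hmov, hio⟩

/-- … and `¬ B`-recurrent. [folklore] -/
theorem noMovingAlternatingNearChainFromσ_of_recurrent_not {s₀ : MarkedStage.{u}} {G B : MarkedStage.{u} → Prop}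
    (h : NoMovingRecurrentNearChainFromσ σ N ν s₀ G fun s => ¬ B s) : NoMovingAlternatingNearChainFromσ σ N ν s₀ G B :=
  fun ⟨c, h0, hstep, hG, hmov, _, hio⟩ => h ⟨c, h0, hstep, hG, hmov, hio⟩

/-- **«`B` infinitely often» = «eventually `B`» ⊔ «`B` and `¬ B` both infinitely often»** for moving σ-chains — Rec = Ev ⊔ Alt on the nose
(σ-copy of `noMovingRecurrentNearChainFrom_iff_eventually_alternating`, same proof). [folklore] -/
theorem noMovingRecurrentNearChainFromσ_iff_eventually_alternating {s₀ : MarkedStage.{u}} {G : MarkedStage.{u} → Prop}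
    (B : MarkedStage.{u} → Prop) :
    NoMovingRecurrentNearChainFromσ σ N ν s₀ G B ↔
      (NoMovingNearChainFromσ σ N ν s₀ fun s => G s ∧ B s) ∧ NoMovingAlternatingNearChainFromσ σ N ν s₀ G B := by
  constructor
  · intro h
    refine ⟨?_, noMovingAlternatingNearChainFromσ_of_recurrent h⟩
    rintro ⟨c, h0, hstep, hG, hmov⟩
    exact h ⟨c, h0, hstep, fun n => (hG n).1, hmov, fun n => ⟨n, le_rfl, (hG n).2⟩⟩
  · rintro ⟨hev, halt⟩ ⟨c, h0, hstep, hG, hmov, hio⟩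
    rcases eventually_not_or_io (fun n => ¬ B (c n)) with ⟨n₀, hn₀⟩ | hioN
    · exact hev ⟨fun n => c (n₀ + n), reachesσ_chain h0 hstep n₀, fun n => hstep (n₀ + n),
        fun n => ⟨hG _, Classical.not_not.1 (hn₀ _ (Nat.le_add_right _ _))⟩, io_shift hmov n₀⟩
    · exact halt ⟨c, h0, hstep, hG, hmov, hio, hioN⟩

/-! ## §2. Row level at `B = Iso 3`, grade `ē ≥ 3`, for the strategy `σ` -/

/-- **Ev-Iso σ ∧ ALT σ ⇒ Rec-Iso σ**, every origin class `Q`. [folklore] -/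
theorem wtopRecIsoMσ_of_evIso_alt {p : ℕ} {Q : ℕ → (ℕ → ℕ) → ∀ X : Scheme.{u}, X → Prop}
    (hev : WtopEvIsoMσ σ p Q) (halt : WtopAltMσ σ p Q) : WtopRecIsoMσ σ p Q :=
  fun ν X _ x hX hQ =>
    (noMovingRecurrentNearChainFromσ_iff_eventually_alternating (fun s => Iso 3 s)).2 ⟨hev ν X x hX hQ, halt ν X x hX hQ⟩

/-- … and conversely Rec-Iso σ gives back both legs (exactness). [folklore] -/
theorem evIso_alt_of_wtopRecIsoMσ {p : ℕ} {Q : ℕ → (ℕ → ℕ) → ∀ X : Scheme.{u}, X → Prop} (h : WtopRecIsoMσ σ p Q) :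
    WtopEvIsoMσ σ p Q ∧ WtopAltMσ σ p Q :=
  ⟨fun ν X _ x hX hQ => ((noMovingRecurrentNearChainFromσ_iff_eventually_alternating (fun s => Iso 3 s)).1 (h ν X x hX hQ)).1,
    fun ν X _ x hX hQ => noMovingAlternatingNearChainFromσ_of_recurrent (h ν X x hX hQ)⟩

/-- ALT σ is implied by Rec-Iso σ. [folklore] -/
theorem wtopAltMσ_of_wtopRecIsoMσ {p : ℕ} {Q : ℕ → (ℕ → ℕ) → ∀ X : Scheme.{u}, X → Prop} (h : WtopRecIsoMσ σ p Q) :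
    WtopAltMσ σ p Q :=
  (evIso_alt_of_wtopRecIsoMσ h).2

/-- ALT σ is implied by Rec-NonIso σ. [folklore] -/
theorem wtopAltMσ_of_wtopRecNonIsoMσ {p : ℕ} {Q : ℕ → (ℕ → ℕ) → ∀ X : Scheme.{u}, X → Prop} (h : WtopRecNonIsoMσ σ p Q) :
    WtopAltMσ σ p Q :=
  fun ν X _ x hX hQ => noMovingAlternatingNearChainFromσ_of_recurrent_not (h ν X x hX hQ)

/-- **Cover A for σ:** Ev-Iso σ ∧ Rec-NonIso σ ⇒ the grade-`≥ 3` moving σ-row at `Q`-origins. [folklore] -/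
theorem atQσ_of_coverA {p : ℕ} {Q : ℕ → (ℕ → ℕ) → ∀ X : Scheme.{u}, X → Prop}
    (hev : WtopEvIsoMσ σ p Q) (hrec : WtopRecNonIsoMσ σ p Q) :
    MaxOriginNoMovingNearChainAtQσ σ p 3 Q fun s => 3 ≤ s.geomDirDim := by
  intro ν X _ x hX hQ
  refine (noMovingNearChainFromσ_iff_recurrence (fun s => ¬ Iso 3 s)).2 ⟨?_, hrec ν X x hX hQ⟩
  exact noMovingNearChainFromσ_mono (fun s hs => ⟨hs.1, Classical.not_not.1 hs.2⟩) (hev ν X x hX hQ)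

/-- **Cover B for σ:** Rec-Iso σ ∧ Ev-NonIso σ (047's `WtopEvNonIsoMσ`) ⇒ the grade-`≥ 3` moving σ-row at `Q`-origins. [folklore] -/
theorem atQσ_of_coverB {p : ℕ} {Q : ℕ → (ℕ → ℕ) → ∀ X : Scheme.{u}, X → Prop}
    (hrec : WtopRecIsoMσ σ p Q) (hev : WtopEvNonIsoMσ σ p Q) :
    MaxOriginNoMovingNearChainAtQσ σ p 3 Q fun s => 3 ≤ s.geomDirDim :=
  fun ν X _ x hX hQ => (noMovingNearChainFromσ_iff_recurrence (fun s => Iso 3 s)).2 ⟨hev ν X x hX hQ, hrec ν X x hX hQ⟩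

/-- **Trichotomy cover for σ:** Ev-Iso σ ∧ Ev-NonIso σ ∧ ALT σ ⇒ the grade-`≥ 3` moving σ-row at `Q`-origins. [folklore] -/
theorem atQσ_of_trichotomy {p : ℕ} {Q : ℕ → (ℕ → ℕ) → ∀ X : Scheme.{u}, X → Prop}
    (hev : WtopEvIsoMσ σ p Q) (hnon : WtopEvNonIsoMσ σ p Q) (halt : WtopAltMσ σ p Q) :
    MaxOriginNoMovingNearChainAtQσ σ p 3 Q fun s => 3 ≤ s.geomDirDim :=
  fun ν X _ x hX hQ =>
    (noMovingNearChainFromσ_iff_trichotomy (fun s => Iso 3 s)).2 ⟨hev ν X x hX hQ, hnon ν X x hX hQ, halt ν X x hX hQ⟩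

/-- **The covers are exact for σ:** the σ-row gives back Ev-Iso, Rec-NonIso, Rec-Iso, Ev-NonIso and ALT. [folklore] -/
theorem piecesσ_of_atQ {p : ℕ} {Q : ℕ → (ℕ → ℕ) → ∀ X : Scheme.{u}, X → Prop}
    (h : MaxOriginNoMovingNearChainAtQσ σ p 3 Q fun s => 3 ≤ s.geomDirDim) :
    WtopEvIsoMσ σ p Q ∧ WtopRecNonIsoMσ σ p Q ∧ WtopRecIsoMσ σ p Q ∧ WtopEvNonIsoMσ σ p Q ∧ WtopAltMσ σ p Q := by
  refine ⟨fun ν X _ x hX hQ => ?_, fun ν X _ x hX hQ => ?_, fun ν X _ x hX hQ => ?_, fun ν X _ x hX hQ => ?_,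
    fun ν X _ x hX hQ => ?_⟩
  · exact noMovingNearChainFromσ_mono (fun s hs => hs.1) (h ν X x hX hQ)
  · exact ((noMovingNearChainFromσ_iff_recurrence (fun s => ¬ Iso 3 s)).1 (h ν X x hX hQ)).2
  · exact ((noMovingNearChainFromσ_iff_recurrence (fun s => Iso 3 s)).1 (h ν X x hX hQ)).2
  · exact ((noMovingNearChainFromσ_iff_recurrence (fun s => Iso 3 s)).1 (h ν X x hX hQ)).1
  · exact ((noMovingNearChainFromσ_iff_trichotomy (fun s => Iso 3 s)).1 (h ν X x hX hQ)).2.2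

/-! ## §3. The eventually-isolated σ-row from the strategy-free kernel and the σ-extraction -/

/-- **Ev-Iso σ FROM THE KERNEL**: the isolated quadratic kernel `IsoQuadraticTowerTerminates p 3` (oracle/strategy/label-free) and the
σ-extraction `IsoTailTowerExtractionMσ σ p` give `WtopEvIsoMσ σ p Q` for EVERY origin class `Q` (σ-copy of r4's `wtopEvIsoM_of_towers`, same
proof). The extraction binder is a THEOREM for admissible functional σ (`Sigma.isoTailTowerExtractionMσ_of_admissible`,
`…Corridor3SigmaIsoExtraction`). [folklore] -/
theorem wtopEvIsoMσ_of_towers {p : ℕ} (hT : IsoQuadraticTowerTerminates.{u} p 3) (hE : IsoTailTowerExtractionMσ σ p)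
    (Q : ℕ → (ℕ → ℕ) → ∀ X : Scheme.{u}, X → Prop) : WtopEvIsoMσ σ p Q := by
  intro ν X _ x hX _hQ
  rintro ⟨c, h0, hstep, hG, hmov⟩
  obtain ⟨T, pt, hT0, htower⟩ := hE ν X x hX c h0 hstep hG hmov
  exact hT ν T pt hT0 htower

/-! ## §4. ALT for σ from the σ-transition law and the σ-birth law -/

/-- **ALT σ FROM «NO RECURRENT ISO POINT BIRTHS» (σ-form)** (σ-copy of res-type-067's `wtopAltM_of_noRecurrentIsoPointBirth3`, same proof):
an alternating moving σ-chain has an iso → non-iso transition at consecutive stages beyond every bound (after a late isolated stage `m` take the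
FIRST later non-isolated stage); by the σ-transition law that step carries an iso point birth, which the σ-birth law forbids from some stage
on. [folklore] -/
theorem wtopAltMσ_of_noRecurrentIsoPointBirth3σ {p : ℕ} {Q : ℕ → (ℕ → ℕ) → ∀ X : Scheme.{u}, X → Prop}
    (hT : IsoTransitionLaw3σ σ p Q) (hrec : NoRecurrentIsoPointBirth3σ σ p Q) : WtopAltMσ σ p Q := by
  classical
  intro ν X _ x hX hQ
  rintro ⟨c, h0, hstep, hG, hmov, hio, hnio⟩
  obtain ⟨n₁, hn₁⟩ := hrec ν X x hX hQ c h0 hstep hG hmov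
  obtain ⟨m, hm, hmI⟩ := hio n₁
  obtain ⟨m', hm', hm'N⟩ := hnio m
  have hex : ∃ j, m < j ∧ ¬ Iso 3 (c j) := by
    refine ⟨m', lt_of_le_of_ne hm' ?_, hm'N⟩
    rintro rfl
    exact hm'N hmI
  obtain ⟨hj₀m, hj₀N⟩ := Nat.find_spec hex
  have hmin : ∀ j, j < Nat.find hex → ¬ (m < j ∧ ¬ Iso 3 (c j)) := fun j hj => Nat.find_min hex hj
  obtain ⟨k, hk⟩ : ∃ k, Nat.find hex = k + 1 := Nat.exists_eq_succ_of_ne_zero (by omega)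
  have hkI : Iso 3 (c k) := by
    by_cases hkm : k = m
    · rw [hkm]; exact hmI
    · by_contra hnot
      exact hmin k (by omega) ⟨by omega, hnot⟩
  have hk1 : ¬ Iso 3 (c (k + 1)) := by
    rw [← hk]; exact hj₀N
  obtain ⟨f, hf, Z', hZ'⟩ := hT ν X x hX hQ c h0 hstep hG k hkI hk1
  exact hn₁ k (by omega) f hf Z' hZ'

/-! ## §5. THE σ-CLOSERS BY NAME -/

/-- **THE σ-CLOSER (RULINGS v3.14-11a (CP)), every origin class `Q`:** Rec-Iso for the strategy `σ` from the σ-extraction, the strategy-free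
isolated KERNEL, the σ-transition law and the σ-birth law — Ev-Iso σ through §3, ALT σ through §4, joined by Rec = Ev ⊔ Alt (§1). For an
admissible functional σ the extraction binder is discharged (`…Corridor3SigmaIsoExtraction`), leaving KERNEL ∧ σ-laws. OURS join. -/
theorem wtopRecIsoMσ_of_kernel {p : ℕ} (Q : ℕ → (ℕ → ℕ) → ∀ X : Scheme.{u}, X → Prop) (hE : IsoTailTowerExtractionMσ σ p)
    (hT : IsoQuadraticTowerTerminates.{u} p 3) (hlaw : IsoTransitionLaw3σ σ p Q) (hrec : NoRecurrentIsoPointBirth3σ σ p Q) :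
    WtopRecIsoMσ σ p Q :=
  wtopRecIsoMσ_of_evIso_alt (wtopEvIsoMσ_of_towers hT hE Q) (wtopAltMσ_of_noRecurrentIsoPointBirth3σ hlaw hrec)

/-- **THE POINTED σ-CLOSER `wtopRecIsoMσ_pointed_of_kernel` (the name asked by RULINGS v3.14-11a (CP)):** the σ-form of the v8.2 pointed stub's
closer `wtopRecIsoM_pointed_of_kernel_of_birthLaw` (p521299) — `WtopRecIsoMσ σ p QPointed` from the σ-extraction, the KERNEL, the σ-transition law
at pointed origins and the σ-birth law at pointed origins. OURS join. -/
theorem wtopRecIsoMσ_pointed_of_kernel {p : ℕ} (hE : IsoTailTowerExtractionMσ σ p) (hT : IsoQuadraticTowerTerminates.{u} p 3)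
    (hlaw : IsoTransitionLaw3σ σ p QPointed) (hrec : NoRecurrentIsoPointBirth3σ σ p QPointed) : WtopRecIsoMσ σ p QPointed :=
  wtopRecIsoMσ_of_kernel QPointed hE hT hlaw hrec

/-- **THE FULL W-top σ-ROW AT `Q` (cover B with the kernel):** from the four binders of the σ-closer AND 047's Ev-NonIso σ-row at `Q` — the shape
the σ-side of `stub_Wtop_elimination` consumes origin by origin (`MaxOriginNoMovingNearChainAtQσ σ p 3 Q (3 ≤ ē)` = no moving W-top σ-chain
at all from a `Q`-maximal origin). OURS join. -/
theorem atQσ_of_kernel_evNonIso {p : ℕ} (Q : ℕ → (ℕ → ℕ) → ∀ X : Scheme.{u}, X → Prop) (hE : IsoTailTowerExtractionMσ σ p)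
    (hT : IsoQuadraticTowerTerminates.{u} p 3) (hlaw : IsoTransitionLaw3σ σ p Q) (hrec : NoRecurrentIsoPointBirth3σ σ p Q)
    (hev : WtopEvNonIsoMσ σ p Q) : MaxOriginNoMovingNearChainAtQσ σ p 3 Q fun s => 3 ≤ s.geomDirDim :=
  atQσ_of_coverB (wtopRecIsoMσ_of_kernel Q hE hT hlaw hrec) hev

/-- **CJS SANITY: at `σ := Strategy.cjs R` (functional admissible `R`) three of the four binders are LANDED theorems** — the extraction
(res-D-pv-042 `isoTailTowerExtractionM_holds`), the transition law (res-L1-type-o1 `isoTransitionLaw3_holds`), read through the `Iff.rfl`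
transports of `…Corridor3SigmaIsoDefs` — so the σ-closer specialises to p521299's `wtopRecIsoM_pointed_of_kernel_of_birthLaw` binder for binder
(KERNEL ∧ `NoRecurrentIsoPointBirth3 p Q`). OURS join. -/
theorem wtopRecIsoMσ_cjs_of_birthLaw {p : ℕ} (Q : ℕ → (ℕ → ℕ) → ∀ X : Scheme.{u}, X → Prop)
    {R : ∀ S : Scheme.{u}, CentreSeq S → Prop} (hRf : OracleFunctional R) (hRa : OracleAdmissible R)
    (hT : IsoQuadraticTowerTerminates.{u} p 3) (hrec : NoRecurrentIsoPointBirth3.{u} p Q) :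
    WtopRecIsoMσ (Strategy.cjs R) p Q :=
  wtopRecIsoMσ_of_kernel Q ((isoTailTowerExtractionM_iff_forall_cjs p).1 (isoTailTowerExtractionM_holds p) R hRf hRa) hT
    ((isoTransitionLaw3_iff_forall_cjs p Q).1 (isoTransitionLaw3_holds p Q) R hRf hRa)
    ((noRecurrentIsoPointBirth3_iff_forall_cjs p Q).1 hrec R hRf hRa)

/-- … and assembling over all functional admissible oracles gives back the registered row `WtopRecIsoM p Q` (in particular p521299's pointed
closer at `Q = QPointed`) — the σ-closer LOSES NOTHING at CJS. OURS join. -/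
theorem wtopRecIsoM_of_birthLaw_via_sigma {p : ℕ} (Q : ℕ → (ℕ → ℕ) → ∀ X : Scheme.{u}, X → Prop)
    (hT : IsoQuadraticTowerTerminates.{u} p 3) (hrec : NoRecurrentIsoPointBirth3.{u} p Q) : WtopRecIsoM.{u} p Q :=
  (wtopRecIsoM_iff_forall_cjs p Q).2 fun _ hRf hRa => wtopRecIsoMσ_cjs_of_birthLaw Q hRf hRa hT hrec

end Summit.ResolutionOfSingularities.ResolutionOfSingularities.Theorems.SigmaMaxModificationsCorridor3.Sigma

end
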